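import Summits.Langlands.Langlands.Theorems.PhantomRMYoshidaResiduallyYoshidaLiftingResidualTriangularAux
import HarnessLib

/-!
# Residual block-triangular form with irreducible diagonal blocks
(crux `PhantomRMYoshida.ResiduallyYoshidaLifting`, item stmt-Langlands-13639, line
`endoscopic-crossing-euler`, stub `stub_residualTriangular` — pure representation theory)

Let `k₀` be an algebraically closed field, `f : k₀ → k` a field homomorphism, `Γ` a group,
`ρ : Γ → GL₄(k₀)` and `σ, σ' : Γ → GL₂(k)` irreducible on `k²`, with
`f(det(X - ρ g)) = det(X - σ g) · det(X - σ' g)` for all `g`.  Then (`stub_residualTriangular`)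
there are `w ∈ GL₄(k₀)`, homomorphisms `a, d : Γ → GL₂(k₀)` and `b : Γ → M₂(k₀)` with
`w⁻¹ ρ(g) w = (a g, b g; 0, d g)` (blocks along `finSumFinEquiv : Fin 2 ⊕ Fin 2 ≃ Fin 4`) and
`a ⊗_f k`, `d ⊗_f k` irreducible.

Proof (the lemmas are in the sibling file `PhantomRMYoshidaResiduallyYoshidaLiftingResidualTriangularAux.lean`).
*No stable line* (`eq_zero_of_forall_smul_of_charpoly`): a matrix representation
`ψ : Γ → GL_n(k)` which is semisimple on `kⁿ` with `det(X - ψ g) = det(X - σ g) det(X - σ' g)` is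
equivalent to `σ ⊕ σ'` by the Brauer–Nesbitt theorem over an arbitrary field (Bourbaki, *Algèbre*
VIII § 20 n° 6, Thm. 2, Cor. 1; tree `Representation.nonempty_equiv_of_charpoly_eq`), and a common
eigenvector of `σ ⊕ σ'` has both components zero (each spans a stable subspace of dimension `≤ 1`
of an irreducible plane); hence (`false_of_charpoly_fin_one_mul`) no pair `χ : Γ → GL₁(k)`,
`D : Γ → GL₃(k)` has `det(X - χ g) det(X - D g) = det(X - σ g) det(X - σ' g)` (semisimplify both,
`exists_semisimplification`; the first coordinate line of `χ^ss ⊕ D^ss` is stable).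
*Reducibility over `k₀`*: were `ρ` irreducible, Burnside (`span_eq_top_of_isIrreducible`,
`span_range_map_eq_top_iff`, `isIrreducible_of_span_eq_top`) would make `ρ ⊗_f k` irreducible,
hence semisimple and (Brauer–Nesbitt) equivalent to the reducible `σ ⊕ σ'`.  *Dévissage with an
explicit change of basis* (`exists_conj_eq_fromBlocks`, the computation of
`exists_blocks_of_subrepresentation` in an adapted basis of `k₀⁴ = W₀ ⊕ C`): `w⁻¹ ρ w` is block
upper triangular with blocks of ranks `(m, 4 - m)`, `m = dim W₀`; `m = 1` or `m = 3` would split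
off a character over `k` — excluded — so `m = 2`; and a reducible diagonal block would again split
off a character (`isIrreducible_of_charpoly_mul`).

References: N. Bourbaki, *Algèbre, Chapitre VIII*, 2ᵉ éd. (2012), § 20 n° 6 [BourbakiAlgebreVIII2012];
P. Deligne, J.-P. Serre, *Formes modulaires de poids 1*, ASENS 7 (1974), 6.12 [DeligneSerreASENS1974];
C. W. Curtis, I. Reiner, *Methods of Representation Theory* I (1981), §16B.
-/

noncomputable section

set_option linter.dupNamespace false -- project-wide option (lakefile weak.linter.dupNamespace); `Summit.Langlands.Langlands` is the mandated namespace

open scoped MatrixGroups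
open Matrix Module Literature.RepresentationTheory.Semisimple

namespace Summit.Langlands.Langlands.Cruxes.ResiduallyYoshidaLifting.EndoscopicCrossingEuler

/-- **Stub 2b (residual algebra: block-triangular form over an algebraically closed subfield, irreducible
diagonal blocks).**  `k₀` algebraically closed, `f : k₀ → k` a field map, `ρ : Γ → GL₄(k₀)`, `σ, σ' : Γ → GL₂(k)`
irreducible on `k²`, and `f(det(X - ρ g)) = det(X - σ g) det(X - σ' g)` for all `g`.  Then there are
`w ∈ GL₄(k₀)`, homomorphisms `a, d : Γ → GL₂(k₀)` and `b : Γ → M₂(k₀)` with `w⁻¹ ρ(g) w = (a g, b g; 0, d g)` (blocks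
along `finSumFinEquiv : Fin 2 ⊕ Fin 2 ≃ Fin 4`), and `a, d` irreducible over `k`.  Why true: the representation
`τ = σ ⊕ σ'` on `k⁴` is semisimple and contains no `Γ`-stable line (a stable line projects to zero in the irreducible
planes `σ, σ'`); if `ρ ⊗ k` were irreducible it would be semisimple with the characteristic polynomials of `τ`, hence
equivalent to `τ` (Brauer–Nesbitt, `Representation.nonempty_equiv_of_charpoly_eq`) and reducible — so `ρ ⊗ k` is
reducible, hence (Burnside over the algebraically closed `k₀`: `span_eq_top_of_isIrreducible`,
`span_range_map_eq_top_iff`, `isIrreducible_of_span_eq_top`) `ρ` is reducible over `k₀`; dévissage along a proper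
stable `k₀`-subspace `W₀` (adapted basis, as in `exists_blocks_of_subrepresentation`) gives blocks of ranks
`(m, 4 - m)`; `m = 1` or `3` (and likewise a reducible diagonal block) would, after semisimplifying
(`exists_semisimplification`) and Brauer–Nesbitt, put a `Γ`-stable LINE inside `τ` — excluded
(`false_of_charpoly_fin_one_mul`, `isIrreducible_of_charpoly_mul`).  Non-conjugacy of `σ, σ'` is not needed.
[cite: BourbakiAlgebreVIII2012, VIII §20 n°6 Thm 2 Cor 1; DeligneSerreASENS1974, 6.12] -/
theorem stub_residualTriangular :
    ∀ (k₀ k : Type) [Field k₀] [IsAlgClosed k₀] [Field k] (f : k₀ →+* k)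
      (Γ : Type) [Group Γ] (ρ : Γ →* GL (Fin 4) k₀) (σ σ' : Γ →* GL (Fin 2) k),
      Representation.IsIrreducible ((Representation.ofDistribMulAction k (GL (Fin 2) k) (Fin 2 → k)).comp σ) →
      Representation.IsIrreducible ((Representation.ofDistribMulAction k (GL (Fin 2) k) (Fin 2 → k)).comp σ') →
      (∀ g, ((ρ g).val.charpoly).map f = (σ g).val.charpoly * (σ' g).val.charpoly) →
      ∃ (w : GL (Fin 4) k₀) (a d : Γ →* GL (Fin 2) k₀) (b : Γ → Matrix (Fin 2) (Fin 2) k₀),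
        (∀ g, (w⁻¹ * ρ g * w).val =
          Matrix.reindex finSumFinEquiv finSumFinEquiv (Matrix.fromBlocks (a g).val (b g) 0 (d g).val)) ∧
        Representation.IsIrreducible ((Representation.ofDistribMulAction k (GL (Fin 2) k) (Fin 2 → k)).comp
            ((Matrix.GeneralLinearGroup.map f).comp a)) ∧
        Representation.IsIrreducible ((Representation.ofDistribMulAction k (GL (Fin 2) k) (Fin 2 → k)).comp
            ((Matrix.GeneralLinearGroup.map f).comp d)) := by
  intro k₀ k _ _ _ f Γ _ ρ σ σ' hσ hσ' hcp
  classical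
  -- `ρ` is reducible over `k₀` (Burnside descent from `k`, Brauer–Nesbitt over `k`)
  have hred : ¬ Representation.IsIrreducible
      ((Representation.ofDistribMulAction k₀ (GL (Fin 4) k₀) (Fin 4 → k₀)).comp ρ) := by
    intro hirr
    haveI := hirr
    have hspan := span_eq_top_of_isIrreducible ρ
    have hspan' : Submodule.span k (Set.range fun g ↦
        (((Matrix.GeneralLinearGroup.map f).comp ρ g : GL (Fin 4) k) :
          Matrix (Fin 4) (Fin 4) k)) = ⊤ := by
      simp_rw [coe_map_comp_apply]
      exact (span_range_map_eq_top_iff f _).2 hspan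
    have hirr' := isIrreducible_of_span_eq_top (by norm_num) _ hspan'
    set Rσ : Representation k Γ (Fin 2 → k) :=
      (Representation.ofDistribMulAction k (GL (Fin 2) k) (Fin 2 → k)).comp σ
    set Rσ' : Representation k Γ (Fin 2 → k) :=
      (Representation.ofDistribMulAction k (GL (Fin 2) k) (Fin 2 → k)).comp σ'
    set R : Representation k Γ (Fin 4 → k) :=
      (Representation.ofDistribMulAction k (GL (Fin 4) k) (Fin 4 → k)).comp
        ((Matrix.GeneralLinearGroup.map f).comp ρ)
    haveI : IsSimpleOrder (Subrepresentation R) := hirr'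
    haveI : IsSimpleOrder (Subrepresentation Rσ) := hσ
    haveI : IsSimpleOrder (Subrepresentation Rσ') := hσ'
    have h : ∀ g, (R g).charpoly = ((Rσ.prod Rσ') g).charpoly := fun g ↦ by
      rw [show (Rσ.prod Rσ') g = (Rσ g).prodMap (Rσ' g) from rfl, LinearMap.charpoly_prodMap,
        charpoly_glRep_apply, charpoly_glRep_apply, charpoly_glRep_apply, coe_map_comp_apply,
        Matrix.charpoly_map, hcp]
    obtain ⟨e⟩ := Representation.nonempty_equiv_of_charpoly_eq R (Rσ.prod Rσ') h
    exact not_isIrreducible_prod Rσ Rσ' (Representation.isIrreducible_of_equiv e)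
  obtain ⟨W₀, hW0, hW1⟩ := exists_ne_bot_ne_top_of_not_isIrreducible _ hred
  -- a complement and the ranks
  have hbot : (⊥ : Subrepresentation
      ((Representation.ofDistribMulAction k₀ (GL (Fin 4) k₀) (Fin 4 → k₀)).comp ρ)).toSubmodule = ⊥ :=
    rfl
  have htop : (⊤ : Subrepresentation
      ((Representation.ofDistribMulAction k₀ (GL (Fin 4) k₀) (Fin 4 → k₀)).comp ρ)).toSubmodule = ⊤ :=
    rfl
  have hWS0 : W₀.toSubmodule ≠ ⊥ := fun h ↦
    hW0 (Subrepresentation.toSubmodule_injective (h.trans hbot.symm))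
  have hWS1 : W₀.toSubmodule ≠ ⊤ := fun h ↦
    hW1 (Subrepresentation.toSubmodule_injective (h.trans htop.symm))
  obtain ⟨C, hWC⟩ := Submodule.exists_isCompl W₀.toSubmodule
  obtain ⟨m, hm⟩ : ∃ m, finrank k₀ W₀.toSubmodule = m := ⟨_, rfl⟩
  obtain ⟨p, hp⟩ : ∃ p, finrank k₀ C = p := ⟨_, rfl⟩
  have hmp : m + p = 4 := by
    rw [← hm, ← hp, Submodule.finrank_add_eq_of_isCompl hWC, finrank_fin_fun]
  have hm0 : 0 < m := Nat.pos_of_ne_zero fun h ↦ hWS0 (Submodule.finrank_eq_zero.mp (hm.trans h))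
  have hp0 : 0 < p := by
    refine Nat.pos_of_ne_zero fun h ↦ hWS1 ?_
    have hC : C = ⊥ := Submodule.finrank_eq_zero.mp (hp.trans h)
    have := hWC.sup_eq_top
    rwa [hC, sup_bot_eq] at this
  let bW : Basis (Fin m) k₀ W₀.toSubmodule := finBasisOfFinrankEq k₀ W₀.toSubmodule hm
  let bC : Basis (Fin p) k₀ C := finBasisOfFinrankEq k₀ C hp
  -- block form along `W₀ ⊕ C`, and the characteristic polynomials of the blocks over `k`
  have key : ∀ e : Fin m ⊕ Fin p ≃ Fin 4, ∃ (w : GL (Fin 4) k₀) (A : Γ →* GL (Fin m) k₀)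
      (D : Γ →* GL (Fin p) k₀) (B : Γ → Matrix (Fin m) (Fin p) k₀),
      (∀ g, (w⁻¹ * ρ g * w).val =
        Matrix.reindex e e (Matrix.fromBlocks (A g).val (B g) 0 (D g).val)) ∧
      ∀ g, (((Matrix.GeneralLinearGroup.map f).comp A g : GL (Fin m) k) :
          Matrix (Fin m) (Fin m) k).charpoly *
        (((Matrix.GeneralLinearGroup.map f).comp D g : GL (Fin p) k) :
          Matrix (Fin p) (Fin p) k).charpoly =
        (σ g).val.charpoly * (σ' g).val.charpoly := by
    intro e
    obtain ⟨w, A, D, B, hw⟩ := exists_conj_eq_fromBlocks ρ W₀ C hWC bW bC e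
    refine ⟨w, A, D, B, hw, fun g ↦ ?_⟩
    rw [coe_map_comp_apply, coe_map_comp_apply, Matrix.charpoly_map, Matrix.charpoly_map,
      ← Polynomial.map_mul, ← charpoly_eq_of_conj_eq_fromBlocks e (hw g), hcp]
  -- `m = 1` and `m = 3` would split off a character over `k`
  obtain ⟨-, A₁, D₁, -, -, hcp₁⟩ := key (finSumFinEquiv.trans (finCongr hmp))
  have hm1 : m ≠ 1 := by
    rintro rfl
    obtain rfl : p = 3 := by omega
    exact false_of_charpoly_fin_one_mul hσ hσ' _ _ hcp₁
  have hm3 : m ≠ 3 := by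
    rintro rfl
    obtain rfl : p = 1 := by omega
    exact false_of_charpoly_fin_one_mul hσ hσ' _ _ fun g ↦ by rw [mul_comm]; exact hcp₁ g
  obtain rfl : m = 2 := by omega
  obtain rfl : p = 2 := by omega
  -- the block form along `finSumFinEquiv`, with irreducible diagonal blocks
  obtain ⟨w, a, d, b, hw, hcp₂⟩ := key finSumFinEquiv
  exact ⟨w, a, d, b, hw, isIrreducible_of_charpoly_mul hσ hσ' _ _ hcp₂,
    isIrreducible_of_charpoly_mul hσ hσ' _ _ fun g ↦ by rw [mul_comm]; exact hcp₂ g⟩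

end Summit.Langlands.Langlands.Cruxes.ResiduallyYoshidaLifting.EndoscopicCrossingEuler

end
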